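import Literature.Topology.FourManifolds.HCobordismWallTrickOdd
import Literature.Topology.FourManifolds.SmoothIntersectionForms
import HarnessLib

/-!
# Wall's Theorem 2 for odd forms of rank one (`Q ≅ ⟨±1⟩`) from (R) + Thom: the model is `S² ×~ S²` itself and the mover is the identity

Topic `Literature/Topology/FourManifolds`; fact seat of
`Literature.Topology.FourManifolds.isHCobordant_of_equivalent_intersectionForm` (**Wall 1964,
Thm. 2**; C. T. C. Wall, *On simply-connected 4-manifolds*, J. London Math. Soc. 39 (1964), §2
pp. 144–146).  Sequel of `HCobordismWallTrickOdd.lean` (odd forms of rank `≥ 2` representing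
`±1`).  For `Q⟦μ⟧ ≅ Q⟦ν⟧` odd of rank `1` the connected sum `N′ = M # (−N)` has
`Q_{N′} ≅ ⟨1⟩ ⊕ ⟨-1⟩ ≅ !![0,1;1,1] = Q_T` for the twisted surgery `T = S² ×~ S²` of `𝕊⁴`, which
bounds the twisted filling `V_T` (`exists_twistedFilling`); so Wall's §2 assembly is run with
`∂V = T` itself (no `S² × S²` summand): `N′ ∼ T` by the rank-`≥ 2` theorem
(`isHCobordant_of_equivalent_intersectionForm_of_not_isEven_of_realisedWallGenerators'`, `m = 0`),
the detector is `⟨e, ·⟩` and `L = ℤe`; and the MOVER IS THE IDENTITY: the rank-one isotropic direct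
summands of `!![0,1;1,1]` are exactly `ℤe` and `ℤ(2f − e)` (`eq_or_twin_of_rank_one`: an isotropic
`a e + c f` has `c (2a + c) = 0`), while the graphs of `α` and `−α` are two DISTINCT such summands
of `Q_{N′}` — so one of them is carried onto `L` by `θ` already (`exists_graphMover_rank_one`).

Main results: `isHCobordant_of_rank_one_of_oddModel` (abstract model),
`isHCobordant_of_equivalent_intersectionForm_of_not_isEven_of_rank_one'` (from (R) + Thom) and
`…_of_rank_one_of_thmX2'`.  Everything is proved; no named fact is introduced (D-0026).

## References

* C. T. C. Wall, *On simply-connected 4-manifolds*, J. London Math. Soc. 39 (1964) 141–149,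
  Thm. 2, §2 pp. 144–146. [WallJLMS1964]
* R. C. Kirby, *The topology of 4-manifolds*, LNM 1374 (1989), Ch. X, proofs of Thm. 1
  (pp. 55–56) and Thm. 2 (pp. 58, 61–62). [Kirby1989]
-/

noncomputable section

open scoped Manifold ContDiff Topology
open Set Function Module CategoryTheory CategoryTheory.Limits
open Literature.AlgebraicTopology.SingularHomology Literature.AlgebraicTopology.Homotopy
open LinearMap (BilinForm)

namespace Literature.Topology.FourManifolds

/-- Local notation: `𝔼 n` is the model Euclidean space `EuclideanSpace ℝ (Fin n)`. -/
local notation "𝔼 " n:arg => EuclideanSpace ℝ (Fin n)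

/-- Local notation: `𝕊 n` is the unit sphere in `EuclideanSpace ℝ (Fin (n + 1))`. -/
local notation "𝕊 " n:arg => (Metric.sphere (0 : EuclideanSpace ℝ (Fin (n + 1))) 1)

/-- Local notation: `Q⟦μ⟧` is the intersection form on `H²(·; ℤ)/T`. -/
local notation "Q⟦" μ "⟧" =>
  Literature.AlgebraicTopology.SingularHomology.intersectionForm two_add_two_eq_four μ

/-! ### Rank-one isotropic direct summands of `!![0,1;1,1]` -/

section RankOne

/-- **The isotropic direct summands of `!![0,1;1,1]` are `ℤe` and `ℤ(2f − e)`**: in a unimodular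
`ℤ`-lattice with a basis `(e; f)` (indexed by `(Unit ⊕ Fin 0) ⊕ (Unit ⊕ Fin 0)`) of Gram matrix
`!![0,1;1,1]`, a complemented isotropic submodule of half rank is `span {e}` or `span {f + f - e}`:
a nonzero `v = a e + c f` in it has `c (2a + c) = 0`; by saturation `e` (resp. `f + f - e`) lies in
it, and isotropy against that vector forces every element onto the same line.  Any `ℤ`-module
structure. [cite: WallJLMS1964, §2, p. 145] -/
theorem eq_or_twin_of_rank_one {W : Type*} [AddCommGroup W] [inst : Module ℤ W] [Module.Free ℤ W]
    [Module.Finite ℤ W] {B : BilinForm ℤ W} (hB : B.IsSymm) (hU : B.IsUnimodular)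
    (b : Basis ((Unit ⊕ Fin 0) ⊕ (Unit ⊕ Fin 0)) ℤ W)
    (hee : B (b (Sum.inl (Sum.inl PUnit.unit))) (b (Sum.inl (Sum.inl PUnit.unit))) = 0)
    (hef : B (b (Sum.inl (Sum.inl PUnit.unit))) (b (Sum.inr (Sum.inl PUnit.unit))) = 1)
    (hff : B (b (Sum.inr (Sum.inl PUnit.unit))) (b (Sum.inr (Sum.inl PUnit.unit))) = 1)
    {K : Submodule ℤ W} (hKc : ∃ K' : Submodule ℤ W, IsCompl K K')
    (hKi : ∀ x ∈ K, ∀ y ∈ K, B x y = 0) (hKr : 2 * finrank ℤ K = finrank ℤ W) :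
    K = Submodule.span ℤ (Set.range (b ∘ Sum.inl)) ∨
      K = Submodule.span ℤ {b (Sum.inr (Sum.inl PUnit.unit)) + b (Sum.inr (Sum.inl PUnit.unit)) -
        b (Sum.inl (Sum.inl PUnit.unit))} := by
  obtain rfl : inst = AddCommGroup.toIntModule W := Subsingleton.elim _ _
  classical
  haveI : B.IsPerfPair := hU
  have hinj : Function.Injective B := (LinearMap.IsPerfPair.bijective_left B).1
  -- the expansion `x = (x·f - x·e) e + (x·e) f`
  have hexp : ∀ x : W, x = (B x (b (Sum.inr (Sum.inl PUnit.unit))) - B x (b (Sum.inl (Sum.inl PUnit.unit)))) •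
      b (Sum.inl (Sum.inl PUnit.unit)) + B x (b (Sum.inl (Sum.inl PUnit.unit))) • b (Sum.inr (Sum.inl PUnit.unit)) := by
    intro x
    have h := eq_expansion_of_ortho_beta hB hinj b hee hef hff (fun j => j.elim0) (fun j => j.elim0)
      (fun j => j.elim0) (fun j => j.elim0) (fun i j => i.elim0) (fun i j => i.elim0) (v := x)
      (fun j => j.elim0)
    simpa using h
  -- `K ≠ ⊥`: a nonzero `v ∈ K`
  have hW : finrank ℤ W = 2 := by
    rw [finrank_eq_card_basis b]
    simp
  have hKne : K ≠ ⊥ := by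
    intro h
    rw [h, finrank_bot] at hKr
    omega
  obtain ⟨v, hvK, hv0⟩ := (Submodule.ne_bot_iff K).1 hKne
  have hvv := hKi v hvK v hvK
  obtain ⟨K', hcK⟩ := hKc
  -- notation
  obtain ⟨e, he⟩ : ∃ e, e = b (Sum.inl (Sum.inl PUnit.unit)) := ⟨_, rfl⟩
  obtain ⟨f, hf⟩ : ∃ f, f = b (Sum.inr (Sum.inl PUnit.unit)) := ⟨_, rfl⟩
  rw [← he, ← hf] at hexp hef
  rw [← hf] at hff
  rw [← he] at hee
  have hfe : B f e = 1 := by rw [hB.eq, hef]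
  -- `C (2A + C) = 0` for `v = A e + C f`
  obtain ⟨A, hA⟩ : ∃ A, A = B v f - B v e := ⟨_, rfl⟩
  obtain ⟨C, hC⟩ : ∃ C, C = B v e := ⟨_, rfl⟩
  have hv' : v = A • e + C • f := by rw [hA, hC]; exact hexp v
  have hquad : C * (2 * A + C) = 0 := by
    have h : B (A • e + C • f) (A • e + C • f) = 0 := by rw [← hv']; exact hvv
    simp only [map_add, map_smul, LinearMap.add_apply, LinearMap.smul_apply, smul_eq_mul, hee, hef,
      hfe, hff] at h
    linear_combination h
  rcases mul_eq_zero.1 hquad with h0 | h0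
  · -- `C = 0`: `v = A e` with `A ≠ 0`, so `e ∈ K`, and `K = ℤe`
    left
    have hva : v = A • e := by rw [hv', h0, zero_smul, add_zero]
    have ha : A ≠ 0 := fun ha => hv0 (by rw [hva, ha, zero_smul])
    have heK : e ∈ K := mem_of_smul_mem_of_isCompl hcK ha (hva ▸ hvK)
    apply le_antisymm
    · intro x hxK
      have hxe : B x e = 0 := hKi x hxK e heK
      have hx : x = (B x f - B x e) • e := by
        conv_lhs => rw [hexp x]
        rw [hxe, zero_smul, add_zero]
      rw [hx, range_comp_inl_eq_insert, ← he]
      exact Submodule.smul_mem _ _ (Submodule.subset_span (Set.mem_insert _ _))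
    · rw [Submodule.span_le, range_comp_inl_eq_insert, ← he]
      rintro _ (rfl | ⟨j, -⟩)
      · exact heK
      · exact j.elim0
  · -- `C = -2A`: `v = -A (f + f - e)`, so `f + f - e ∈ K`, and `K = ℤ(f + f - e)`
    right
    have hC2 : C = -2 * A := by linear_combination h0
    have hva : v = (-A) • (f + f - e) := by
      rw [hv', hC2]
      module
    have ha : -A ≠ 0 := fun ha => hv0 (by rw [hva, ha, zero_smul])
    have hgK : f + f - e ∈ K := mem_of_smul_mem_of_isCompl hcK ha (hva ▸ hvK)
    apply le_antisymm
    · intro x hxK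
      have hxg : B x (f + f - e) = 0 := hKi x hxK _ hgK
      simp only [map_add, map_sub] at hxg
      have hx : x = (B x f) • (f + f - e) := by
        conv_lhs => rw [hexp x]
        rw [show B x e = 2 * B x f by linear_combination -hxg]
        module
      rw [hx, ← he, ← hf]
      exact Submodule.smul_mem _ _ (Submodule.subset_span (Set.mem_singleton _))
    · rw [Submodule.span_le, Set.singleton_subset_iff, ← he, ← hf]
      exact hgK

/-- **The basis `(e; f)` of `H²(T)/T` reindexed by `(Unit ⊕ Fin 0) ⊕ (Unit ⊕ Fin 0)`** (the
core-hyperbolic index with no planes), with its Gram entries. [folklore] -/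
theorem exists_coreBasis_rank_one {W : Type*} [AddCommGroup W] [Module ℤ W] {B : BilinForm ℤ W}
    (bT : Basis (Fin 2) ℤ W) (h00 : B (bT 0) (bT 0) = 0) (h01 : B (bT 0) (bT 1) = 1)
    (h11 : B (bT 1) (bT 1) = 1) :
    ∃ bP : Basis ((Unit ⊕ Fin 0) ⊕ (Unit ⊕ Fin 0)) ℤ W,
      B (bP (Sum.inl (Sum.inl PUnit.unit))) (bP (Sum.inl (Sum.inl PUnit.unit))) = 0 ∧
      B (bP (Sum.inl (Sum.inl PUnit.unit))) (bP (Sum.inr (Sum.inl PUnit.unit))) = 1 ∧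
      B (bP (Sum.inr (Sum.inl PUnit.unit))) (bP (Sum.inr (Sum.inl PUnit.unit))) = 1 ∧
      (∀ u, bP (Sum.inl (Sum.inl u)) = bT 0) ∧ (∀ u, bP (Sum.inr (Sum.inl u)) = bT 1) := by
  classical
  let σ : ((Unit ⊕ Fin 0) ⊕ (Unit ⊕ Fin 0)) ≃ Fin 2 :=
    { toFun := Sum.elim (fun _ => 0) fun _ => 1
      invFun := fun i => if i = 0 then Sum.inl (Sum.inl PUnit.unit) else Sum.inr (Sum.inl PUnit.unit)
      left_inv := by
        rintro ((⟨⟩ | j) | (⟨⟩ | j))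
        · simp
        · exact j.elim0
        · simp
        · exact j.elim0
      right_inv := by
        intro i
        rcases Fin.exists_fin_two.1 ⟨i, rfl⟩ with h | h <;> simp [h] }
  have hσ0 : ∀ u, σ (Sum.inl (Sum.inl u)) = 0 := fun _ => rfl
  have hσ1 : ∀ u, σ (Sum.inr (Sum.inl u)) = 1 := fun _ => rfl
  have he : ∀ u, (bT.reindex σ.symm) (Sum.inl (Sum.inl u)) = bT 0 := fun u => by
    rw [Basis.reindex_apply, Equiv.symm_symm, hσ0]
  have hf : ∀ u, (bT.reindex σ.symm) (Sum.inr (Sum.inl u)) = bT 1 := fun u => by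
    rw [Basis.reindex_apply, Equiv.symm_symm, hσ1]
  refine ⟨bT.reindex σ.symm, ?_, ?_, ?_, he, hf⟩
  · rw [he, h00]
  · rw [he, hf, h01]
  · rw [hf, h11]

end RankOne

/-! ### The graph mover for rank one is the identity -/

section GraphMoverRankOne

/-- **For rank-one odd forms the graph mover is the identity**: for `T` closed simply connected
with a basis `(e; f)` of `H²(T)/T` of Gram `!![0,1;1,1]`, `N` closed simply connected with
`H²(N)/T = H²(M₁)/T ⊕ H²(M₂)/T`, `Q_N = Q⟦μ⟧ ⊕ (−Q⟦ν⟧)`, an isometry `α` and `H²(M₁)/T ≠ 0`, and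
a `±`-isometric bijection `θ : H²(N)/T → H²(T)/T`, one of the graphs of `α`, `−α` is carried by
`θ` onto `ℤe`: both images are rank-one isotropic direct summands, hence `ℤe` or `ℤ(2f − e)`
(`eq_or_twin_of_rank_one`), and they are distinct (`αw ≠ −αw` for `w ≠ 0`).
[cite: WallJLMS1964, §2, p. 145] -/
theorem exists_graphMover_rank_one {T : Type} [TopologicalSpace T] [T2Space T]
    [SecondCountableTopology T] [ChartedSpace (𝔼 4) T] [CompactSpace T] [IsManifold (𝓡 4) ∞ T]
    [SimplyConnectedSpace T] (μT : HomologicalOrientation ℤ T 4)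
    (bP : Basis ((Unit ⊕ Fin 0) ⊕ (Unit ⊕ Fin 0)) ℤ ↥(freeCohomology ℤ T 2))
    (hee : Q⟦μT⟧ (bP (Sum.inl (Sum.inl PUnit.unit))) (bP (Sum.inl (Sum.inl PUnit.unit))) = 0)
    (hef : Q⟦μT⟧ (bP (Sum.inl (Sum.inl PUnit.unit))) (bP (Sum.inr (Sum.inl PUnit.unit))) = 1)
    (hff : Q⟦μT⟧ (bP (Sum.inr (Sum.inl PUnit.unit))) (bP (Sum.inr (Sum.inl PUnit.unit))) = 1)
    {M₁ M₂ N : Type} [TopologicalSpace M₁] [TopologicalSpace M₂]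
    [TopologicalSpace N] [CompactSpace N] [T2Space N] [ChartedSpace (𝔼 4) N] [SimplyConnectedSpace N]
    (μ : HomologicalOrientation ℤ M₁ 4) (ν : HomologicalOrientation ℤ M₂ 4)
    (π : HomologicalOrientation ℤ N 4)
    [Module.Free ℤ ↥(freeCohomology ℤ M₁ 2)] [Module.Finite ℤ ↥(freeCohomology ℤ M₁ 2)]
    [Module.Free ℤ ↥(freeCohomology ℤ M₂ 2)] [Module.Finite ℤ ↥(freeCohomology ℤ M₂ 2)]
    {sM : ↥(freeCohomology ℤ N 2) →ₗ[ℤ] ↥(freeCohomology ℤ M₁ 2)}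
    {sN : ↥(freeCohomology ℤ N 2) →ₗ[ℤ] ↥(freeCohomology ℤ M₂ 2)}
    (hst : Function.Bijective fun x => (sM x, sN x))
    (hQN : ∀ x y, Q⟦π⟧ x y = Q⟦μ⟧ (sM x) (sM y) - Q⟦ν⟧ (sN x) (sN y))
    (α : (Q⟦μ⟧).IsometryEquiv (Q⟦ν⟧)) (hM₁ : ∃ w : ↥(freeCohomology ℤ M₁ 2), w ≠ 0)
    (βo : HomologicalOrientation ℤ T 4)
    (θ : ↥(freeCohomology ℤ N 2) →ₗ[ℤ] ↥(freeCohomology ℤ T 2)) (hθ : Function.Bijective θ)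
    (hθf : ∃ d : ℤ, (d = 1 ∨ d = -1) ∧ ∀ x y, Q⟦βo⟧ (θ x) (θ y) = d * Q⟦π⟧ x y) :
    ∃ (e : (Q⟦μ⟧).IsometryEquiv (Q⟦ν⟧)) (g : T ≃ₘ⟮𝓡 4, 𝓡 4⟯ T),
      Submodule.map (freeCohomology.map (R := ℤ) (⟨g, g.continuous⟩ : C(T, T)) 2)
        (Submodule.map θ (graphSubmodule sM sN (e : ↥(freeCohomology ℤ M₁ 2) →ₗ[ℤ] ↥(freeCohomology ℤ M₂ 2)))) =
        Submodule.span ℤ (Set.range (bP ∘ Sum.inl)) := by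
  classical
  obtain ⟨hfinT, hfreeT⟩ := finite_and_free_freeCohomology_two (M := T)
  haveI := hfinT
  haveI := hfreeT
  have hsymmT : (Q⟦μT⟧).IsSymm :=
    isSymm_intersectionForm (cupProduct_gradedComm_holds ℤ T) even_two two_add_two_eq_four μT
  have hUT : (Q⟦μT⟧).IsUnimodular := isPerfPair_intersectionForm_four_of_compactSpace (M := T) μT
  -- `θ` is a `±`-isometry into `Q⟦μT⟧`
  obtain ⟨d, hd, hdform⟩ := hθf
  obtain ⟨d', -, hθ'⟩ : ∃ d' : ℤ, (d' = 1 ∨ d' = -1) ∧ ∀ x y, Q⟦μT⟧ (θ x) (θ y) = d' * Q⟦π⟧ x y := by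
    rcases HomologicalOrientation.eq_or_eq_neg_of_connected_holds T βo μT with h | h
    · exact ⟨d, hd, fun x y => by rw [← h]; exact hdform x y⟩
    · refine ⟨-d, ?_, fun x y => ?_⟩
      · rcases hd with rfl | rfl
        · right; rfl
        · left; norm_num
      · have h1 := hdform x y
        rw [h, intersectionForm_neg (HomologicalOrientation.fundamentalClass_neg_holds ℤ T 4)
          two_add_two_eq_four μT, LinearMap.neg_apply, LinearMap.neg_apply] at h1
        linear_combination -h1
  -- the negation isometry `τ = -1` of `Q⟦ν⟧`
  let τ : (Q⟦ν⟧).IsometryEquiv (Q⟦ν⟧) :=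
    { LinearEquiv.neg ℤ with
      map_app' := fun n m => by simp }
  have hτ : ∀ y, τ y = -y := fun y => rfl
  -- the two graphs are Lagrangian direct summands of `H²(T)/T`
  have hlag : ∀ e' : (Q⟦μ⟧).IsometryEquiv (Q⟦ν⟧),
      (∃ K', IsCompl (Submodule.map θ (graphSubmodule sM sN (e' : _ →ₗ[ℤ] _))) K') ∧
      (∀ x ∈ Submodule.map θ (graphSubmodule sM sN (e' : _ →ₗ[ℤ] _)),
        ∀ y ∈ Submodule.map θ (graphSubmodule sM sN (e' : _ →ₗ[ℤ] _)), Q⟦μT⟧ x y = 0) ∧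
      2 * finrank ℤ (Submodule.map θ (graphSubmodule sM sN (e' : _ →ₗ[ℤ] _))) =
        finrank ℤ ↥(freeCohomology ℤ T 2) := fun e' => by
    obtain ⟨hc, hi, hr⟩ := graphSubmodule_lagrangian hst hQN e'
    exact lagrangian_map_of_bijective θ hθ hθ' hc hi hr
  -- … and distinct
  obtain ⟨w, hw0⟩ := hM₁
  have hne : Submodule.map θ (graphSubmodule sM sN (α : _ →ₗ[ℤ] _)) ≠
      Submodule.map θ (graphSubmodule sM sN ((α.trans τ : (Q⟦μ⟧).IsometryEquiv (Q⟦ν⟧)) : _ →ₗ[ℤ] _)) := by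
    intro h
    have h' := Submodule.map_injective_of_injective hθ.1 h
    obtain ⟨x, hx⟩ := hst.2 (w, α w)
    have hsx : sM x = w := congrArg Prod.fst hx
    have htx : sN x = α w := congrArg Prod.snd hx
    have hx₁ : x ∈ graphSubmodule sM sN (α : _ →ₗ[ℤ] _) :=
      (mem_graphSubmodule_iff _ _).2 (by rw [hsx, htx]; rfl)
    rw [h'] at hx₁
    have hx₂ := (mem_graphSubmodule_iff _ _).1 hx₁
    rw [hsx, htx] at hx₂
    have hneg : α w = -(α w) :=
      calc α w = (α.trans τ) w := hx₂
        _ = -(α w) := rfl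
    haveI : IsAddTorsionFree ↥(freeCohomology ℤ M₂ 2) := IsAddTorsionFree.of_isTorsionFree ℤ _
    exact hw0 (α.injective ((self_eq_neg.1 hneg).trans (map_zero α).symm))
  -- the identity diffeomorphism
  have hid : ∀ K : Submodule ℤ ↥(freeCohomology ℤ T 2),
      Submodule.map (freeCohomology.map (R := ℤ)
        (⟨Diffeomorph.refl (𝓡 4) T ∞, (Diffeomorph.refl (𝓡 4) T ∞).continuous⟩ : C(T, T)) 2) K = K := by
    intro K
    rw [show (⟨Diffeomorph.refl (𝓡 4) T ∞, (Diffeomorph.refl (𝓡 4) T ∞).continuous⟩ : C(T, T)) =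
      ContinuousMap.id T from rfl, freeCohomology.map_id]
    exact Submodule.map_id K
  rcases eq_or_twin_of_rank_one hsymmT hUT bP hee hef hff (hlag α).1 (hlag α).2.1 (hlag α).2.2
    with h₁ | h₁
  · exact ⟨α, Diffeomorph.refl (𝓡 4) T ∞, (hid _).trans h₁⟩
  rcases eq_or_twin_of_rank_one hsymmT hUT bP hee hef hff (hlag (α.trans τ)).1
    (hlag (α.trans τ)).2.1 (hlag (α.trans τ)).2.2 with h₂ | h₂
  · exact ⟨α.trans τ, Diffeomorph.refl (𝓡 4) T ∞, (hid _).trans h₂⟩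
  exact absurd (h₁.trans h₂.symm) hne

end GraphMoverRankOne

/-! ### Wall's §2 assembly for rank one over the abstract twisted filling -/

section AssemblyRankOne

/-- **Wall's Theorem 2 for odd forms of rank one over an abstract twisted filling.**  Data: (R);
Thom's theorem; closed simply connected `M`, `N` with an isometry `α : Q⟦μ⟧ ≅ Q⟦ν⟧`, `Q⟦μ⟧` odd
of rank `1`; a compact simply connected `V_T` with boundary datum `bW` (boundary `T`) carrying
the per-orientation basis/dying data of `exists_twistedFilling` and `H₂(T) → H₂(V_T)` onto.
Conclusion: `M`, `N` are h-cobordant — the filling clause of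
`isHCobordant_of_wallFilling_of_graphMover` over `∂V_T = T`: `Q_{N′} ≅ Q_T` odd of rank `2`
representing `1` (`exists_isometryEquiv_of_splitting_of_not_isEven`), so `N′ ∼ T` by the
rank-`≥ 2` theorem; detector `⟨e, ·⟩`, `L = ℤe`, and the identity mover
(`exists_graphMover_rank_one`). [cite: WallJLMS1964, Thm. 2 and §2 pp. 144–146] -/
theorem isHCobordant_of_rank_one_of_oddModel
    (hR : ∀ (X : Type) [TopologicalSpace X] [T2Space X] [SecondCountableTopology X]
      [ChartedSpace (𝔼 4) X] [CompactSpace X] [IsManifold (𝓡 4) ∞ X] [SimplyConnectedSpace X]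
      (ξ : HomologicalOrientation ℤ X 4)
      (_hX : (Q⟦ξ⟧).IsIndefinite ∨ Module.finrank ℤ ↥(freeCohomology ℤ X 2) ≤ 8)
      (Y : Type) [TopologicalSpace Y] [T2Space Y] [SecondCountableTopology Y]
      [ChartedSpace (𝔼 4) Y] [CompactSpace Y] [IsManifold (𝓡 4) ∞ Y]
      (_hY : IsConnectedSum (𝓡 4) (𝓡 4) ((𝓡 2).prod (𝓡 2)) X ((𝕊 2) × (𝕊 2)) Y)
      (υ : HomologicalOrientation ℤ Y 4) (V : Type) [AddCommGroup V] (Q : BilinForm ℤ V)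
      (hQ : Q.IsSymm) (_e : Q.IsometryEquiv (Q⟦ξ⟧))
      (_Θ₀ : (Q.prod hyperbolicForm).IsometryEquiv (Q⟦υ⟧)),
      ∃ Θ : (Q.prod hyperbolicForm).IsometryEquiv (Q⟦υ⟧),
        ∀ s ∈ wallGenerators hQ, IsRealisedByDiffeomorph υ (Θ.symm.trans (s.trans Θ)))
    (h2 : isOrientedBordant_of_signature_eq.{0})
    {M N : Type} [TopologicalSpace M] [T2Space M] [SecondCountableTopology M]
    [ChartedSpace (𝔼 4) M] [CompactSpace M] [IsManifold (𝓡 4) ∞ M] [SimplyConnectedSpace M]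
    [TopologicalSpace N] [T2Space N] [SecondCountableTopology N]
    [ChartedSpace (𝔼 4) N] [CompactSpace N] [IsManifold (𝓡 4) ∞ N] [SimplyConnectedSpace N]
    (μ : HomologicalOrientation ℤ M 4) (ν : HomologicalOrientation ℤ N 4)
    (α : (Q⟦μ⟧).IsometryEquiv (Q⟦ν⟧)) (hodd : ¬ (Q⟦μ⟧).IsEven)
    (h1 : Module.finrank ℤ ↥(freeCohomology ℤ M 2) = 1)
    {W₀ : Type} [TopologicalSpace W₀] [T2Space W₀] [SecondCountableTopology W₀]
    [ChartedSpace (EuclideanHalfSpace (4 + 1)) W₀] [IsManifold (𝓡∂ (4 + 1)) ∞ W₀] [CompactSpace W₀]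
    [SimplyConnectedSpace W₀]
    (bW : BoundaryData (𝓡∂ (4 + 1)) W₀ (𝓡 4)) [T2Space bW.carrier]
    [SecondCountableTopology bW.carrier] [CompactSpace bW.carrier] [SimplyConnectedSpace bW.carrier]
    (hTbasis : ∀ μT : HomologicalOrientation ℤ bW.carrier 4,
      ∃ bT : Basis (Fin 2) ℤ ↥(freeCohomology ℤ bW.carrier 2),
        Q⟦μT⟧ (bT 0) (bT 0) = 0 ∧ Q⟦μT⟧ (bT 0) (bT 1) = 1 ∧ Q⟦μT⟧ (bT 1) (bT 1) = 1 ∧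
        ∀ y : singularHomology ℤ ℤ bW.carrier 2, freeKroneckerPairing bW.carrier 2 (bT 0) y = 0 →
          singularHomology.map ℤ ℤ bW.inclC 2 y = 0)
    (hTepi : Epi (singularHomology.map ℤ ℤ bW.inclC 2)) : IsHCobordant 4 M N := by
  classical
  obtain ⟨μT⟩ := isOrientableOver_of_simplyConnectedSpace ℤ bW.carrier (n := 4)
  obtain ⟨bT, hT00, hT01, hT11, hTdie⟩ := hTbasis μT
  obtain ⟨bP, hee, hef, hff, hbPe, -⟩ := exists_coreBasis_rank_one (B := Q⟦μT⟧) bT hT00 hT01 hT11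
  -- the lattices of `M`, `N`, `T`
  obtain ⟨hfinM, hfreeM⟩ := finite_and_free_freeCohomology_two (M := M)
  obtain ⟨hfinN, hfreeN⟩ := finite_and_free_freeCohomology_two (M := N)
  obtain ⟨hfinT, hfreeT⟩ := finite_and_free_freeCohomology_two (M := bW.carrier)
  haveI := hfinM
  haveI := hfreeM
  haveI := hfinN
  haveI := hfreeN
  haveI := hfinT
  haveI := hfreeT
  have hsymmT : (Q⟦μT⟧).IsSymm :=
    isSymm_intersectionForm (cupProduct_gradedComm_holds ℤ bW.carrier) even_two two_add_two_eq_four μT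
  have hM₁ : ∃ w : ↥(freeCohomology ℤ M 2), w ≠ 0 :=
    (Module.finrank_pos_iff_exists_ne_zero (R := ℤ)).1 (by rw [h1]; exact Nat.one_pos)
  have h1' : Module.finrank ℤ ↥(freeCohomology ℤ M 2) = 0 + 1 := by rw [h1]
  refine isHCobordant_of_wallFilling_of_graphMover M N μ ν
    (fun N' _ _ _ _ _ _ _ π sM sN hst hQ' => ?_)
  -- `Q_{N'} ≅ Q_T` odd of rank `2` representing `1`: `N' ∼ T` by the rank-`≥ 2` theorem
  obtain ⟨⟨e⟩, hoddN', -⟩ := exists_isometryEquiv_of_splitting_of_not_isEven μ ν π hst hQ' α hodd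
    hsymmT h1' bP hee hef hff (fun j => j.elim0) (fun j => j.elim0) (fun j => j.elim0)
    (fun j => j.elim0) (fun i j => i.elim0) (fun i j => i.elim0) (fun i j => i.elim0)
  have hrank2 : 2 ≤ Module.finrank ℤ ↥(freeCohomology ℤ N' 2) := by
    rw [e.toLinearEquiv.finrank_eq, finrank_eq_card_basis bT]
    simp
  obtain ⟨Chc, hChc⟩ :=
    isHCobordant_of_equivalent_intersectionForm_of_not_isEven_of_realisedWallGenerators' hR h2 π μT
      ⟨e⟩ hoddN' ⟨bT 1, Or.inl hT11⟩ hrank2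
  -- the detector `⟨e, ·⟩` and `L = ℤe`
  let π₀ : singularHomology ℤ ℤ bW.carrier 2 →ₗ[ℤ] (Unit ⊕ Fin 0 → ℤ) :=
    LinearMap.pi fun a => freeKroneckerPairing bW.carrier 2 (bP (Sum.inl a))
  have hπ₀ : ∀ y, π₀ y = 0 ↔ ∀ a, freeKroneckerPairing bW.carrier 2 (bP (Sum.inl a)) y = 0 :=
    fun y => ⟨fun h a => congrFun h a, fun h => funext h⟩
  -- (the instances of `W₀` by `inferInstance`: `‹_›` is prohibitively slow here)
  refine ⟨W₀, inferInstance, inferInstance, inferInstance, inferInstance, inferInstance, inferInstance,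
    inferInstance, bW, inferInstance, inferInstance, Chc,
    (Unit ⊕ Fin 0 → ℤ), inferInstance, inferInstance, inferInstance, π₀,
    Submodule.span ℤ (Set.range (bP ∘ Sum.inl)), hChc, hTepi, fun y hy => ?_, fun c hc => ?_,
    fun βo θ hθ hθf => ?_⟩
  · -- `ker π₀` dies in `V_T`
    refine hTdie y ?_
    rw [← hbPe PUnit.unit]
    exact (hπ₀ y).1 hy (Sum.inl PUnit.unit)
  · -- `Ann (ker π₀) ⊆ L`
    exact mem_span_sumInl_of_forall_kronecker bP c fun y hy => hc y ((hπ₀ y).2 hy)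
  · -- the (identity) graph mover
    exact exists_graphMover_rank_one μT bP hee hef hff μ ν π hst hQ' α hM₁ βo θ hθ hθf

end AssemblyRankOne

/-! ### Wall's Theorem 2 for odd forms of rank one, from (R) -/

section MainRankOne

/-- **Wall's Theorem 2 for ODD forms of rank `1` (`Q ≅ ⟨±1⟩`, the homotopy `ℂP²`'s and
`ℂP²̄`'s), from the realisation (R) of Kirby's generators of one `S² × S²` summand and Thom's
theorem** — Wall's trick over the twisted filling of `S² ×~ S²` (`exists_twistedFilling`) with the
identity mover (`isHCobordant_of_rank_one_of_oddModel`).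
[cite: WallJLMS1964, Thm. 2 (p. 141) and §2 pp. 144–146] [cite: Kirby1989, Ch. X, Thm. 2 (p. 58)] -/
theorem isHCobordant_of_equivalent_intersectionForm_of_not_isEven_of_rank_one'
    (hR : ∀ (X : Type) [TopologicalSpace X] [T2Space X] [SecondCountableTopology X]
      [ChartedSpace (𝔼 4) X] [CompactSpace X] [IsManifold (𝓡 4) ∞ X] [SimplyConnectedSpace X]
      (ξ : HomologicalOrientation ℤ X 4)
      (_hX : (Q⟦ξ⟧).IsIndefinite ∨ Module.finrank ℤ ↥(freeCohomology ℤ X 2) ≤ 8)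
      (Y : Type) [TopologicalSpace Y] [T2Space Y] [SecondCountableTopology Y]
      [ChartedSpace (𝔼 4) Y] [CompactSpace Y] [IsManifold (𝓡 4) ∞ Y]
      (_hY : IsConnectedSum (𝓡 4) (𝓡 4) ((𝓡 2).prod (𝓡 2)) X ((𝕊 2) × (𝕊 2)) Y)
      (υ : HomologicalOrientation ℤ Y 4) (V : Type) [AddCommGroup V] (Q : BilinForm ℤ V)
      (hQ : Q.IsSymm) (_e : Q.IsometryEquiv (Q⟦ξ⟧))
      (_Θ₀ : (Q.prod hyperbolicForm).IsometryEquiv (Q⟦υ⟧)),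
      ∃ Θ : (Q.prod hyperbolicForm).IsometryEquiv (Q⟦υ⟧),
        ∀ s ∈ wallGenerators hQ, IsRealisedByDiffeomorph υ (Θ.symm.trans (s.trans Θ)))
    (h2 : isOrientedBordant_of_signature_eq.{0})
    {M N : Type} [TopologicalSpace M] [T2Space M] [SecondCountableTopology M]
    [ChartedSpace (𝔼 4) M] [CompactSpace M] [IsManifold (𝓡 4) ∞ M] [SimplyConnectedSpace M]
    [TopologicalSpace N] [T2Space N] [SecondCountableTopology N]
    [ChartedSpace (𝔼 4) N] [CompactSpace N] [IsManifold (𝓡 4) ∞ N] [SimplyConnectedSpace N]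
    (μ : HomologicalOrientation ℤ M 4) (ν : HomologicalOrientation ℤ N 4)
    (hQ : (Q⟦μ⟧).Equivalent (Q⟦ν⟧)) (hodd : ¬ (Q⟦μ⟧).IsEven)
    (h1 : Module.finrank ℤ ↥(freeCohomology ℤ M 2) = 1) : IsHCobordant 4 M N := by
  obtain ⟨α⟩ := hQ
  obtain ⟨W₀, _, _, _, _, _, _, _, bW, _, _, _, _, hTbasis, hTepi⟩ := exists_twistedFilling
  exact isHCobordant_of_rank_one_of_oddModel hR h2 μ ν α hodd h1 bW hTbasis hTepi

/-- **Wall's Theorem 2 for odd forms of rank one, from Kirby's Thm. X.2 and Thom's theorem.**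
[cite: WallJLMS1964, Thm. 2 (p. 141)] [cite: Kirby1989, Ch. X, Thm. 2 (p. 58)] -/
theorem isHCobordant_of_equivalent_intersectionForm_of_not_isEven_of_rank_one_of_thmX2'
    (h1 : exists_diffeomorph_freeCohomologyMap_eq_of_isometryEquiv)
    (h2 : isOrientedBordant_of_signature_eq.{0})
    {M N : Type} [TopologicalSpace M] [T2Space M] [SecondCountableTopology M]
    [ChartedSpace (𝔼 4) M] [CompactSpace M] [IsManifold (𝓡 4) ∞ M] [SimplyConnectedSpace M]
    [TopologicalSpace N] [T2Space N] [SecondCountableTopology N]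
    [ChartedSpace (𝔼 4) N] [CompactSpace N] [IsManifold (𝓡 4) ∞ N] [SimplyConnectedSpace N]
    (μ : HomologicalOrientation ℤ M 4) (ν : HomologicalOrientation ℤ N 4)
    (hQ : (Q⟦μ⟧).Equivalent (Q⟦ν⟧)) (hodd : ¬ (Q⟦μ⟧).IsEven)
    (hrank : Module.finrank ℤ ↥(freeCohomology ℤ M 2) = 1) : IsHCobordant 4 M N :=
  isHCobordant_of_equivalent_intersectionForm_of_not_isEven_of_rank_one'
    (realisedWallGenerators_of_thmX2 h1) h2 μ ν hQ hodd hrank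

end MainRankOne

/-! ### All odd forms that are indefinite or represent `±1` (every rank), and the union with the even case -/

section AllForms

/-- **An odd indefinite unimodular lattice has a vector of square `1` or `-1`** (Serre, *A Course
in Arithmetic*, Ch. V §2.2 Thm. 4: it is `s I₊ ⊕ t I₋`; the tree's
`isDiagonalizable_of_isOdd_of_isIndefinite` with Serre's Thm. 3
`exists_isotropic_of_isIndefinite_holds`, and `apply_basis_self_eq_one_or_of_isOrthoᵢ`),
transported to an arbitrary `Module ℤ` instance. [cite: Serre1973, Ch. V §2.2 Thm. 4] -/
theorem exists_apply_self_eq_one_or_of_isOdd_of_isIndefinite {W : Type} [AddCommGroup W]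
    [inst : Module ℤ W] [Module.Finite ℤ W] [Module.Free ℤ W] {B : BilinForm ℤ W} (hB : B.IsSymm)
    (hU : B.IsUnimodular) (hodd : B.IsOdd) (hind : B.IsIndefinite) :
    ∃ z : W, B z z = 1 ∨ B z z = -1 := by
  obtain rfl : inst = AddCommGroup.toIntModule W := Subsingleton.elim _ _
  obtain ⟨ι, b, hb⟩ := LinearMap.BilinForm.isDiagonalizable_of_isOdd_of_isIndefinite
    LinearMap.BilinForm.exists_isotropic_of_isIndefinite_holds hB hU hodd hind
  obtain ⟨x, hx⟩ := hind.exists_ne_zero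
  haveI : Nontrivial W := ⟨⟨x, 0, hx⟩⟩
  obtain ⟨i⟩ := b.index_nonempty
  exact ⟨b i, LinearMap.BilinForm.apply_basis_self_eq_one_or_of_isOrthoᵢ hU hb i⟩

/-- **Wall's Theorem 2 for ODD forms that are indefinite or represent `±1` — every rank — from
(R) and Thom's theorem.**  Odd forms have rank `≥ 1`; rank `1` is
`…_of_not_isEven_of_rank_one'` (identity mover over `S² ×~ S²`); in rank `≥ 2` an indefinite odd
form represents `±1` (`exists_apply_self_eq_one_or_of_isOdd_of_isIndefinite`, Serre V Thm. 4) and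
`…_of_not_isEven_of_realisedWallGenerators'` applies.  NOT covered: odd DEFINITE forms with no
vector of square `±1` (rank `≥ 2`, not `≅ ±I_n`) — for closed smooth 4-manifolds these are
excluded by Donaldson's theorem, which is not used here.
[cite: WallJLMS1964, Thm. 2 (p. 141) and §2 pp. 144–146] [cite: Serre1973, Ch. V §2.2 Thm. 4] -/
theorem isHCobordant_of_equivalent_intersectionForm_of_not_isEven_of_realisedWallGenerators''
    (hR : ∀ (X : Type) [TopologicalSpace X] [T2Space X] [SecondCountableTopology X]
      [ChartedSpace (𝔼 4) X] [CompactSpace X] [IsManifold (𝓡 4) ∞ X] [SimplyConnectedSpace X]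
      (ξ : HomologicalOrientation ℤ X 4)
      (_hX : (Q⟦ξ⟧).IsIndefinite ∨ Module.finrank ℤ ↥(freeCohomology ℤ X 2) ≤ 8)
      (Y : Type) [TopologicalSpace Y] [T2Space Y] [SecondCountableTopology Y]
      [ChartedSpace (𝔼 4) Y] [CompactSpace Y] [IsManifold (𝓡 4) ∞ Y]
      (_hY : IsConnectedSum (𝓡 4) (𝓡 4) ((𝓡 2).prod (𝓡 2)) X ((𝕊 2) × (𝕊 2)) Y)
      (υ : HomologicalOrientation ℤ Y 4) (V : Type) [AddCommGroup V] (Q : BilinForm ℤ V)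
      (hQ : Q.IsSymm) (_e : Q.IsometryEquiv (Q⟦ξ⟧))
      (_Θ₀ : (Q.prod hyperbolicForm).IsometryEquiv (Q⟦υ⟧)),
      ∃ Θ : (Q.prod hyperbolicForm).IsometryEquiv (Q⟦υ⟧),
        ∀ s ∈ wallGenerators hQ, IsRealisedByDiffeomorph υ (Θ.symm.trans (s.trans Θ)))
    (h2 : isOrientedBordant_of_signature_eq.{0})
    {M N : Type} [TopologicalSpace M] [T2Space M] [SecondCountableTopology M]
    [ChartedSpace (𝔼 4) M] [CompactSpace M] [IsManifold (𝓡 4) ∞ M] [SimplyConnectedSpace M]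
    [TopologicalSpace N] [T2Space N] [SecondCountableTopology N]
    [ChartedSpace (𝔼 4) N] [CompactSpace N] [IsManifold (𝓡 4) ∞ N] [SimplyConnectedSpace N]
    (μ : HomologicalOrientation ℤ M 4) (ν : HomologicalOrientation ℤ N 4)
    (hQ : (Q⟦μ⟧).Equivalent (Q⟦ν⟧)) (hodd : ¬ (Q⟦μ⟧).IsEven)
    (hu : (Q⟦μ⟧).IsIndefinite ∨ ∃ z : ↥(freeCohomology ℤ N 2), Q⟦ν⟧ z z = 1 ∨ Q⟦ν⟧ z z = -1) :
    IsHCobordant 4 M N := by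
  classical
  obtain ⟨hfinM, hfreeM⟩ := finite_and_free_freeCohomology_two (M := M)
  obtain ⟨hfinN, hfreeN⟩ := finite_and_free_freeCohomology_two (M := N)
  haveI := hfinM
  haveI := hfreeM
  haveI := hfinN
  haveI := hfreeN
  have hsymmν : (Q⟦ν⟧).IsSymm :=
    isSymm_intersectionForm (cupProduct_gradedComm_holds ℤ N) even_two two_add_two_eq_four ν
  have hUν : (Q⟦ν⟧).IsUnimodular := isPerfPair_intersectionForm_four_of_compactSpace (M := N) ν
  -- odd forms have positive rank
  have hpos : 0 < Module.finrank ℤ ↥(freeCohomology ℤ M 2) := by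
    rw [Module.finrank_pos_iff_exists_ne_zero]
    have h := hodd
    simp only [LinearMap.BilinForm.IsEven, not_forall] at h
    obtain ⟨x, hx⟩ := h
    refine ⟨x, fun h0 => hx ?_⟩
    rw [h0]
    exact ⟨0, by simp⟩
  by_cases h1 : Module.finrank ℤ ↥(freeCohomology ℤ M 2) = 1
  · exact isHCobordant_of_equivalent_intersectionForm_of_not_isEven_of_rank_one' hR h2 μ ν hQ hodd h1
  · have h2le : 2 ≤ Module.finrank ℤ ↥(freeCohomology ℤ M 2) := by omega
    have hunit : ∃ z : ↥(freeCohomology ℤ N 2), Q⟦ν⟧ z z = 1 ∨ Q⟦ν⟧ z z = -1 := by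
      rcases hu with hind | hz
      · obtain ⟨α⟩ := hQ
        have hoddν : (Q⟦ν⟧).IsOdd := by
          intro hev
          apply hodd
          intro x
          have h := hev (α x)
          rwa [α.map_app] at h
        exact exists_apply_self_eq_one_or_of_isOdd_of_isIndefinite hsymmν hUν hoddν
          (hind.of_equivalent ⟨α⟩)
      · exact hz
    exact isHCobordant_of_equivalent_intersectionForm_of_not_isEven_of_realisedWallGenerators' hR h2
      μ ν hQ hodd hunit h2le

/-- **Wall's Theorem 2 from the realisation (R) of Kirby's generators of one `S² × S²` summand,
Thom's theorem and the even spin-bordism step, for every form that is even, or indefinite, or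
represents `±1`** — the union of Wall's trick for even forms
(`isHCobordant_of_equivalent_intersectionForm_of_isEven_of_realisedWallGenerators'`,
`HCobordismWallTrickEven.lean`) and for odd forms (`…_of_not_isEven_of_realisedWallGenerators''`).
The only forms not covered are the odd definite lattices with no vector of square `±1` (excluded
for smooth closed 4-manifolds by Donaldson's theorem, not used).  No generation theorem for
`O(Q ⊕ H)`, no hyperbolic pair in `Q⟦μ⟧`, no realised complex conjugation.
[cite: WallJLMS1964, Thm. 2 (p. 141) and §2 pp. 144–146]
[cite: Kirby1989, Ch. X, proofs of Thm. 1 (pp. 55–56) and Thm. 2 (pp. 58, 61–62)] -/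
theorem isHCobordant_of_equivalent_intersectionForm_of_realisedWallGenerators_of_evenBordism'
    (hR : ∀ (X : Type) [TopologicalSpace X] [T2Space X] [SecondCountableTopology X]
      [ChartedSpace (𝔼 4) X] [CompactSpace X] [IsManifold (𝓡 4) ∞ X] [SimplyConnectedSpace X]
      (ξ : HomologicalOrientation ℤ X 4)
      (_hX : (Q⟦ξ⟧).IsIndefinite ∨ Module.finrank ℤ ↥(freeCohomology ℤ X 2) ≤ 8)
      (Y : Type) [TopologicalSpace Y] [T2Space Y] [SecondCountableTopology Y]
      [ChartedSpace (𝔼 4) Y] [CompactSpace Y] [IsManifold (𝓡 4) ∞ Y]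
      (_hY : IsConnectedSum (𝓡 4) (𝓡 4) ((𝓡 2).prod (𝓡 2)) X ((𝕊 2) × (𝕊 2)) Y)
      (υ : HomologicalOrientation ℤ Y 4) (V : Type) [AddCommGroup V] (Q : BilinForm ℤ V)
      (hQ : Q.IsSymm) (_e : Q.IsometryEquiv (Q⟦ξ⟧))
      (_Θ₀ : (Q.prod hyperbolicForm).IsometryEquiv (Q⟦υ⟧)),
      ∃ Θ : (Q.prod hyperbolicForm).IsometryEquiv (Q⟦υ⟧),
        ∀ s ∈ wallGenerators hQ, IsRealisedByDiffeomorph υ (Θ.symm.trans (s.trans Θ)))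
    (h2 : isOrientedBordant_of_signature_eq.{0})
    (h3 : ∀ (M N : Type) [TopologicalSpace M] [T2Space M] [SecondCountableTopology M]
      [ChartedSpace (𝔼 4) M] [CompactSpace M] [IsManifold (𝓡 4) ∞ M] [SimplyConnectedSpace M]
      [TopologicalSpace N] [T2Space N] [SecondCountableTopology N]
      [ChartedSpace (𝔼 4) N] [CompactSpace N] [IsManifold (𝓡 4) ∞ N] [SimplyConnectedSpace N]
      (μ : HomologicalOrientation ℤ M 4) (ν : HomologicalOrientation ℤ N 4),
      (Q⟦μ⟧).IsEven → (Q⟦ν⟧).IsEven → μ.signature = ν.signature →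
      ∃ c : Cobordism 4 M N, SimplyConnectedSpace c.W ∧ IsSpin (𝓡∂ (4 + 1)) c.W)
    {M N : Type} [TopologicalSpace M] [T2Space M] [SecondCountableTopology M]
    [ChartedSpace (𝔼 4) M] [CompactSpace M] [IsManifold (𝓡 4) ∞ M] [SimplyConnectedSpace M]
    [TopologicalSpace N] [T2Space N] [SecondCountableTopology N]
    [ChartedSpace (𝔼 4) N] [CompactSpace N] [IsManifold (𝓡 4) ∞ N] [SimplyConnectedSpace N]
    (μ : HomologicalOrientation ℤ M 4) (ν : HomologicalOrientation ℤ N 4)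
    (hQ : (Q⟦μ⟧).Equivalent (Q⟦ν⟧))
    (hu : (Q⟦μ⟧).IsEven ∨ (Q⟦μ⟧).IsIndefinite ∨
      ∃ z : ↥(freeCohomology ℤ N 2), Q⟦ν⟧ z z = 1 ∨ Q⟦ν⟧ z z = -1) : IsHCobordant 4 M N := by
  by_cases hev : (Q⟦μ⟧).IsEven
  · exact isHCobordant_of_equivalent_intersectionForm_of_isEven_of_realisedWallGenerators' hR h2 h3 μ ν
      hQ hev
  · exact isHCobordant_of_equivalent_intersectionForm_of_not_isEven_of_realisedWallGenerators'' hR h2 μ ν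
      hQ hev (hu.resolve_left hev)

/-- **Wall's Theorem 2 from Kirby's Thm. X.2, Thom's theorem and the even spin-bordism step, for
every form that is even, or indefinite, or represents `±1`** (X.2 implies (R):
`realisedWallGenerators_of_thmX2`). [cite: WallJLMS1964, Thm. 2 (p. 141)]
[cite: Kirby1989, Ch. X, Thm. 1 (p. 55) and Thm. 2 (p. 58)] -/
theorem isHCobordant_of_equivalent_intersectionForm_of_thmX2_of_evenBordism'
    (h1 : exists_diffeomorph_freeCohomologyMap_eq_of_isometryEquiv)
    (h2 : isOrientedBordant_of_signature_eq.{0})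
    (h3 : ∀ (M N : Type) [TopologicalSpace M] [T2Space M] [SecondCountableTopology M]
      [ChartedSpace (𝔼 4) M] [CompactSpace M] [IsManifold (𝓡 4) ∞ M] [SimplyConnectedSpace M]
      [TopologicalSpace N] [T2Space N] [SecondCountableTopology N]
      [ChartedSpace (𝔼 4) N] [CompactSpace N] [IsManifold (𝓡 4) ∞ N] [SimplyConnectedSpace N]
      (μ : HomologicalOrientation ℤ M 4) (ν : HomologicalOrientation ℤ N 4),
      (Q⟦μ⟧).IsEven → (Q⟦ν⟧).IsEven → μ.signature = ν.signature →
      ∃ c : Cobordism 4 M N, SimplyConnectedSpace c.W ∧ IsSpin (𝓡∂ (4 + 1)) c.W)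
    {M N : Type} [TopologicalSpace M] [T2Space M] [SecondCountableTopology M]
    [ChartedSpace (𝔼 4) M] [CompactSpace M] [IsManifold (𝓡 4) ∞ M] [SimplyConnectedSpace M]
    [TopologicalSpace N] [T2Space N] [SecondCountableTopology N]
    [ChartedSpace (𝔼 4) N] [CompactSpace N] [IsManifold (𝓡 4) ∞ N] [SimplyConnectedSpace N]
    (μ : HomologicalOrientation ℤ M 4) (ν : HomologicalOrientation ℤ N 4)
    (hQ : (Q⟦μ⟧).Equivalent (Q⟦ν⟧))
    (hu : (Q⟦μ⟧).IsEven ∨ (Q⟦μ⟧).IsIndefinite ∨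
      ∃ z : ↥(freeCohomology ℤ N 2), Q⟦ν⟧ z z = 1 ∨ Q⟦ν⟧ z z = -1) : IsHCobordant 4 M N :=
  isHCobordant_of_equivalent_intersectionForm_of_realisedWallGenerators_of_evenBordism'
    (realisedWallGenerators_of_thmX2 h1) h2 h3 μ ν hQ hu


/-! ### All forms, from (R) + Thom + the even spin-bordism step + Donaldson's diagonalisation theorem -/

/-- A diagonalisable unimodular lattice of positive rank has a vector of square `1` or `-1`
(`apply_basis_self_eq_one_or_of_isOrthoᵢ`), for an arbitrary `Module ℤ` instance.
[cite: Serre1973, Ch. V §1.1, §1.4.1] -/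
theorem exists_apply_self_eq_one_or_of_isDiagonalizable {W : Type} [AddCommGroup W]
    [inst : Module ℤ W] {B : BilinForm ℤ W} (hU : B.IsUnimodular) (hdiag : B.IsDiagonalizable)
    (hW : ∃ x : W, x ≠ 0) : ∃ z : W, B z z = 1 ∨ B z z = -1 := by
  obtain rfl : inst = AddCommGroup.toIntModule W := Subsingleton.elim _ _
  obtain ⟨ι, b, hb⟩ := hdiag
  obtain ⟨x, hx⟩ := hW
  haveI : Nontrivial W := ⟨⟨x, 0, hx⟩⟩
  obtain ⟨i⟩ := b.index_nonempty
  exact ⟨b i, LinearMap.BilinForm.apply_basis_self_eq_one_or_of_isOrthoᵢ hU hb i⟩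

/-- **Wall's Theorem 2 for ALL forms, from the realisation (R) of Kirby's generators of one
`S² × S²` summand, Thom's theorem, the even spin-bordism step and Donaldson's diagonalisation
theorem** (`isDiagonalizable_intersectionForm_of_isDefinite`, Freedman–Quinn 8.4A(1): the
definite odd forms of closed smooth 4-manifolds are `±I_n`, hence represent `±1`).  Donaldson's
theorem replaces here the generation half of Kirby's Thm. X.2 (Wall 1963) used by Wall's own
proof; an anachronistic but honest reduction, complementary to
`isHCobordant_of_equivalent_intersectionForm_of_spinBordism` (`HCobordismWallSpinCase.lean`).
[cite: WallJLMS1964, Thm. 2 (p. 141)] [cite: FreedmanQuinnPMS1990, Thm 8.4A(1)]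
[cite: Kirby1989, Ch. X, Thm. 1 (p. 55) and Thm. 2 (p. 58)] -/
theorem isHCobordant_of_equivalent_intersectionForm_of_realisedWallGenerators_of_donaldson
    (hR : ∀ (X : Type) [TopologicalSpace X] [T2Space X] [SecondCountableTopology X]
      [ChartedSpace (𝔼 4) X] [CompactSpace X] [IsManifold (𝓡 4) ∞ X] [SimplyConnectedSpace X]
      (ξ : HomologicalOrientation ℤ X 4)
      (_hX : (Q⟦ξ⟧).IsIndefinite ∨ Module.finrank ℤ ↥(freeCohomology ℤ X 2) ≤ 8)
      (Y : Type) [TopologicalSpace Y] [T2Space Y] [SecondCountableTopology Y]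
      [ChartedSpace (𝔼 4) Y] [CompactSpace Y] [IsManifold (𝓡 4) ∞ Y]
      (_hY : IsConnectedSum (𝓡 4) (𝓡 4) ((𝓡 2).prod (𝓡 2)) X ((𝕊 2) × (𝕊 2)) Y)
      (υ : HomologicalOrientation ℤ Y 4) (V : Type) [AddCommGroup V] (Q : BilinForm ℤ V)
      (hQ : Q.IsSymm) (_e : Q.IsometryEquiv (Q⟦ξ⟧))
      (_Θ₀ : (Q.prod hyperbolicForm).IsometryEquiv (Q⟦υ⟧)),
      ∃ Θ : (Q.prod hyperbolicForm).IsometryEquiv (Q⟦υ⟧),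
        ∀ s ∈ wallGenerators hQ, IsRealisedByDiffeomorph υ (Θ.symm.trans (s.trans Θ)))
    (h2 : isOrientedBordant_of_signature_eq.{0})
    (h3 : ∀ (M N : Type) [TopologicalSpace M] [T2Space M] [SecondCountableTopology M]
      [ChartedSpace (𝔼 4) M] [CompactSpace M] [IsManifold (𝓡 4) ∞ M] [SimplyConnectedSpace M]
      [TopologicalSpace N] [T2Space N] [SecondCountableTopology N]
      [ChartedSpace (𝔼 4) N] [CompactSpace N] [IsManifold (𝓡 4) ∞ N] [SimplyConnectedSpace N]
      (μ : HomologicalOrientation ℤ M 4) (ν : HomologicalOrientation ℤ N 4),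
      (Q⟦μ⟧).IsEven → (Q⟦ν⟧).IsEven → μ.signature = ν.signature →
      ∃ c : Cobordism 4 M N, SimplyConnectedSpace c.W ∧ IsSpin (𝓡∂ (4 + 1)) c.W)
    (hD : isDiagonalizable_intersectionForm_of_isDefinite.{0})
    {M N : Type} [TopologicalSpace M] [T2Space M] [SecondCountableTopology M]
    [ChartedSpace (𝔼 4) M] [CompactSpace M] [IsManifold (𝓡 4) ∞ M] [SimplyConnectedSpace M]
    [TopologicalSpace N] [T2Space N] [SecondCountableTopology N]
    [ChartedSpace (𝔼 4) N] [CompactSpace N] [IsManifold (𝓡 4) ∞ N] [SimplyConnectedSpace N]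
    (μ : HomologicalOrientation ℤ M 4) (ν : HomologicalOrientation ℤ N 4)
    (hQ : (Q⟦μ⟧).Equivalent (Q⟦ν⟧)) : IsHCobordant 4 M N := by
  classical
  refine isHCobordant_of_equivalent_intersectionForm_of_realisedWallGenerators_of_evenBordism' hR h2 h3
    μ ν hQ ?_
  by_cases hev : (Q⟦μ⟧).IsEven
  · exact Or.inl hev
  right
  by_cases hdef : (Q⟦μ⟧).IsDefinite
  · right
    obtain ⟨α⟩ := hQ
    -- `Q_N` is definite, hence diagonalisable (Donaldson), and of positive rank (`Q_M` is odd)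
    have hdefN : (Q⟦ν⟧).IsDefinite := by
      by_contra h
      exact (LinearMap.BilinForm.IsIndefinite.of_equivalent ⟨α.symm⟩ h) hdef
    obtain ⟨hfinN, hfreeN⟩ := finite_and_free_freeCohomology_two (M := N)
    haveI := hfinN
    haveI := hfreeN
    have hUν : (Q⟦ν⟧).IsUnimodular := isPerfPair_intersectionForm_four_of_compactSpace (M := N) ν
    have hN : ∃ x : ↥(freeCohomology ℤ N 2), x ≠ 0 := by
      have h := hev
      simp only [LinearMap.BilinForm.IsEven, not_forall] at h
      obtain ⟨x, hx⟩ := h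
      refine ⟨α x, fun h0 => hx ?_⟩
      rw [← α.map_app x x, h0]
      exact ⟨0, by simp⟩
    exact exists_apply_self_eq_one_or_of_isDiagonalizable hUν (hD N ν hdefN) hN
  · exact Or.inl hdef

/-- **Wall's Theorem 2 for all forms from Kirby's Thm. X.2, Thom's theorem, the even spin-bordism
step and Donaldson's diagonalisation theorem.** [cite: WallJLMS1964, Thm. 2 (p. 141)]
[cite: FreedmanQuinnPMS1990, Thm 8.4A(1)] -/
theorem isHCobordant_of_equivalent_intersectionForm_of_thmX2_of_donaldson
    (h1 : exists_diffeomorph_freeCohomologyMap_eq_of_isometryEquiv)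
    (h2 : isOrientedBordant_of_signature_eq.{0})
    (h3 : ∀ (M N : Type) [TopologicalSpace M] [T2Space M] [SecondCountableTopology M]
      [ChartedSpace (𝔼 4) M] [CompactSpace M] [IsManifold (𝓡 4) ∞ M] [SimplyConnectedSpace M]
      [TopologicalSpace N] [T2Space N] [SecondCountableTopology N]
      [ChartedSpace (𝔼 4) N] [CompactSpace N] [IsManifold (𝓡 4) ∞ N] [SimplyConnectedSpace N]
      (μ : HomologicalOrientation ℤ M 4) (ν : HomologicalOrientation ℤ N 4),
      (Q⟦μ⟧).IsEven → (Q⟦ν⟧).IsEven → μ.signature = ν.signature →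
      ∃ c : Cobordism 4 M N, SimplyConnectedSpace c.W ∧ IsSpin (𝓡∂ (4 + 1)) c.W)
    (hD : isDiagonalizable_intersectionForm_of_isDefinite.{0})
    {M N : Type} [TopologicalSpace M] [T2Space M] [SecondCountableTopology M]
    [ChartedSpace (𝔼 4) M] [CompactSpace M] [IsManifold (𝓡 4) ∞ M] [SimplyConnectedSpace M]
    [TopologicalSpace N] [T2Space N] [SecondCountableTopology N]
    [ChartedSpace (𝔼 4) N] [CompactSpace N] [IsManifold (𝓡 4) ∞ N] [SimplyConnectedSpace N]
    (μ : HomologicalOrientation ℤ M 4) (ν : HomologicalOrientation ℤ N 4)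
    (hQ : (Q⟦μ⟧).Equivalent (Q⟦ν⟧)) : IsHCobordant 4 M N :=
  isHCobordant_of_equivalent_intersectionForm_of_realisedWallGenerators_of_donaldson
    (realisedWallGenerators_of_thmX2 h1) h2 h3 hD μ ν hQ

end AllForms


end Literature.Topology.FourManifolds

end
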